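import Mathlib
import Literature.NumberTheory.Transcendental.KZCubicalCalculus
import Summits.KontsevichZagierPeriods.KontsevichZagierPeriods.Theorems.InverseLandauTateFamilyKernelStubLinMoments
import Summits.KontsevichZagierPeriods.KontsevichZagierPeriods.Theorems.InverseLandauTateFamilyKernelStubLinMomentsW

/-!
# Crux `TateFamilyKernel` (stmt-KontsevichZagierPeriods-9130), line `Sketch`: `stub_pencilMoments`

The generic analytic input of the quasi-homogeneous pencil step (wave 13, "multi-weight Euler
telescoper") of the lead's skeleton of the crux
`Summit.KontsevichZagierPeriods.KontsevichZagierPeriods.Theses.InverseLandau.TateFamilyKernel`: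
for a pencil `Q = 1 − ϖT` with ARBITRARY `T ∈ ℚ[z₁,z₂]` bounded by `|T|·b ≤ 1` on the closed square
`[0,1]² = KZ.cube 2` (`0 < b`) and a `ϖ`-free numerator `P ∈ ℚ[z₁,z₂]`, if the open-square fibre
integrals `∫_{(0,1)²} P/(1 − ϖT)` vanish for all `ϖ ∈ (0,b)`, then every moment
`∫_{(0,1)²} P·T^k` vanishes.

This is the moment step of the linear / graph-pencil classes (`…StubLinMoments`, `…StubGpMoments`,
`…StubGvMoments`) with the sign condition `T ≥ 0` dropped: only `|ϖT| ≤ ϖ/b < 1` is used.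

* On the open square `|T| ≤ 1/b` (`PencilMoments.abs_T_le`), so for `ϖ ∈ (0,b)` one has
  `|ϖT| ≤ ϖ/b < 1` and `P/(1 − ϖT) = Σ_M (P·T^M) ϖ^M` pointwise (geometric series,
  `hasSum_geometric_of_abs_lt_one`), with the uniform geometric bound `|P·T^M| ≤ K (1/b)^M`
  (`K = max_{[0,1]²} |P|`).
* Term-wise integration and one-sided uniqueness of power-series coefficients
  (`LinMomentsW.integral_coeff_eq_zero` of the landed file `…StubLinMomentsW`: dominated
  convergence for series + isolated zeros of the analytic sum) give `∫ P·T^M = 0` for all `M`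
  (`PencilMoments.moment_eq_zero`), and `aeval (P * T^k) = aeval P * (aeval T)^k`.

References: Kontsevich–Zagier 2001, §1.2 (an elementary real-analysis step of one test class of
the period conjecture). Mathlib, `KZCubicalCalculus` (for `KZ.cube`) and the two landed linear-class
moment files only (helpers `LinMoments.continuous_aeval`, `LinMoments.sq_subset_Icc`,
`LinMomentsW.integral_coeff_eq_zero`); no named fact, no new definition. Helpers live in the
sub-namespace `PencilMoments`.
-/

noncomputable section

open MeasureTheory Set MvPolynomial
open Literature.NumberTheory.Transcendental

namespace Summit.KontsevichZagierPeriods.InverseLandau.TateFamilyKernel.Descent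

namespace PencilMoments

/-! ### The pencil height `T` on the square -/

/-- On the open square, `|T| ≤ 1/b` when `|T|·b ≤ 1` on the closed square `KZ.cube 2` (`0 < b`).
[folklore] -/
theorem abs_T_le {T : MvPolynomial (Fin 2) ℚ} {b : ℝ} (hb : 0 < b)
    (hTb : ∀ z ∈ KZ.cube 2, |aeval z T| * b ≤ 1) {z : Fin 2 → ℝ}
    (hz : z ∈ Set.pi Set.univ (fun _ : Fin 2 => Ioo (0 : ℝ) 1)) :
    |aeval z T| ≤ 1 / b := by
  rw [le_div_iff₀ hb]
  exact hTb z fun i => ⟨((mem_univ_pi.mp hz) i).1.le, ((mem_univ_pi.mp hz) i).2.le⟩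

/-! ### Vanishing of the moments `∫ P·T^M` -/

/-- **Moments.** Under the hypotheses of `stub_pencilMoments`, every moment `∫_□ P·T^M` vanishes:
on the square `|ϖT| ≤ ϖ/b < 1` for `ϖ ∈ (0,b)`, so `P/(1 − ϖT) = Σ_M (P T^M) ϖ^M` with
`|P T^M| ≤ K (1/b)^M`, and term-wise integration plus the one-sided uniqueness of power-series
coefficients (`LinMomentsW.integral_coeff_eq_zero`) apply. [cite: KontsevichZagier2001, §1.2] -/
theorem moment_eq_zero {T P : MvPolynomial (Fin 2) ℚ} {b : ℝ} (hb : 0 < b)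
    (hTb : ∀ z ∈ KZ.cube 2, |aeval z T| * b ≤ 1)
    (hvan : ∀ ϖ ∈ Ioo 0 b, ∫ z in Set.pi Set.univ (fun _ : Fin 2 => Ioo (0 : ℝ) 1),
      aeval z P / (1 - ϖ * aeval z T) = 0) (M : ℕ) :
    ∫ z in Set.pi Set.univ (fun _ : Fin 2 => Ioo (0 : ℝ) 1),
      aeval z P * (aeval z T) ^ M = 0 := by
  -- a uniform bound `K` for `|P|` on the closed square
  obtain ⟨K, hK⟩ :=
    (isCompact_Icc : IsCompact (Icc (0 : Fin 2 → ℝ) 1)).exists_bound_of_continuousOn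
      (LinMoments.continuous_aeval P).continuousOn
  have hR : (0 : ℝ) < 1 / b := one_div_pos.mpr hb
  have hϖR : ∀ ϖ ∈ Ioo 0 b, ϖ * (1 / b) < 1 := fun ϖ hϖ => by
    rw [mul_one_div, div_lt_one hb]
    exact hϖ.2
  refine LinMomentsW.integral_coeff_eq_zero
    (F := fun M z => aeval z P * (aeval z T) ^ M)
    (g := fun ϖ z => aeval z P / (1 - ϖ * aeval z T))
    (K := K) hR hb
    (fun M => (LinMoments.continuous_aeval P).mul ((LinMoments.continuous_aeval T).pow M))
    (fun M z hz => ?_) hϖR (fun ϖ hϖ z hz => ?_) hvan M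
  · -- the uniform geometric bound `|P T^M| ≤ K (1/b)^M`
    have hT := abs_T_le hb hTb hz
    have hPz := hK z (LinMoments.sq_subset_Icc hz)
    rw [Real.norm_eq_abs] at hPz
    rw [abs_mul, abs_pow]
    exact mul_le_mul hPz (pow_le_pow_left₀ (abs_nonneg _) hT M) (pow_nonneg (abs_nonneg _) M)
      ((abs_nonneg _).trans hPz)
  · -- the pointwise geometric expansion `P/(1 − ϖT) = Σ_M P T^M ϖ^M` (`|ϖT| < 1`)
    have hT := abs_T_le hb hTb hz
    have hr1 : |ϖ * aeval z T| < 1 := by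
      rw [abs_mul, abs_of_pos hϖ.1]
      exact lt_of_le_of_lt (mul_le_mul_of_nonneg_left hT hϖ.1.le) (hϖR ϖ hϖ)
    have h := (hasSum_geometric_of_abs_lt_one hr1).mul_left (aeval z P)
    have hfun : (fun n : ℕ => aeval z P * (aeval z T) ^ n * ϖ ^ n) =
        fun n : ℕ => aeval z P * (ϖ * aeval z T) ^ n := by
      funext n
      rw [mul_pow ϖ]
      ring
    show HasSum (fun n : ℕ => aeval z P * (aeval z T) ^ n * ϖ ^ n)
      (aeval z P / (1 - ϖ * aeval z T))
    rw [hfun, div_eq_mul_inv]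
    exact h

end PencilMoments

/-- STUB `stub_pencilMoments` (quasi-homogeneous pencil step: MOMENTS of a vanishing pencil). If
`|T|·b ≤ 1` on the closed square `KZ.cube 2` (`0 < b`) and `∫_{(0,1)²} P/(1 − ϖT) dz = 0` for all
`ϖ ∈ (0,b)`, then every moment `∫_{(0,1)²} P·T^k dz` vanishes: `|ϖT| ≤ ϖ/b < 1` on the square,
the geometric series and dominated convergence expand the fibre integral as the power series
`Σ_M (∫ P T^M) ϖ^M` with coefficients `O(b^{-M})`, and a real power series vanishing on `(0,b)`
has all coefficients zero (`PencilMoments.moment_eq_zero` via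
`LinMomentsW.integral_coeff_eq_zero`, isolated zeros); finally
`aeval (P * T^k) = aeval P * (aeval T)^k`. [cite: KontsevichZagier2001, §1.2] -/
theorem stub_pencilMoments (T P : MvPolynomial (Fin 2) ℚ) (b : ℝ) (hb : 0 < b)
    (hTb : ∀ z ∈ KZ.cube 2, |aeval z T| * b ≤ 1)
    (hvan : ∀ ϖ ∈ Ioo 0 b, ∫ z in Set.pi Set.univ (fun _ : Fin 2 => Ioo (0 : ℝ) 1),
      aeval z P / (1 - ϖ * aeval z T) = 0) :
    ∀ k : ℕ, ∫ z in Set.pi Set.univ (fun _ : Fin 2 => Ioo (0 : ℝ) 1), aeval z (P * T ^ k) = 0 := by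
  intro k
  simp_rw [map_mul, map_pow]
  exact PencilMoments.moment_eq_zero hb hTb hvan k

end Summit.KontsevichZagierPeriods.InverseLandau.TateFamilyKernel.Descent
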